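import Literature.NumberTheory.GelbartRogawski1991.DoubledWeilRepresentationArchLagrangianGen
import Literature.NumberTheory.GelbartRogawski1991.DoubledUnitarySiegelParabolicAlgebraGen
import Literature.NumberTheory.GelbartRogawski1991.DoubledWeilRepresentationRationalSchurGen
import Literature.NumberTheory.GelbartRogawski1991.DoubledWeilRepresentationRationalParabolic
import HarnessLib

/-!
#  Rational clause of the doubled Weil representation, II: the Siegel decomposition and propagation — general `E/F`

General-quadratic-extension twin (namespace `GRConstructionGen`) of `DoubledWeilRepresentationRationalParabolic` (CM case,
namespace `GRConstruction`): the CM field `L ⊃ L⁺` with complex conjugation and `realDiagonal` Gram data is replaced by an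
arbitrary quadratic extension `E/F` of number fields with `c ∈ Aut(E/F)`, `c δ = -δ ≠ 0`, `δ² = d ∈ F`, and symmetric
invertible Gram matrices `TV`, `TW` over `F` (objects of `DoubledUnitaryGlobalSplittingDataGen`).  Statements and proofs are
verbatim transports (the ring-generic lemmas `mem_closure_levi_low_of_toBlocks₁₂_eq_zero`, `toBlocks₁₂_eq_zero_of_mulVec`,
`S3_abstract`, `propagate_abstract`, `reIm_diag'`, `reIm_symm_diag'` are reused from the CM files).

[GelbartRogawski1991, §3.1 Prop. 3.1.1 p. 455 L1–2] by doubling, second half of the rational clause: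
* **S3-dec** `S3dec_siegel_decomposition`: for a RATIONAL Siegel element `p ∈ P_Δ(L⁺)` there is
  `B ∈ Sp_{2(n+n)}(L⁺)` with `ratSp B = ι^𝔻 p` and `δ B δ⁻¹` in the submonoid generated by the rational Levi elements
  and the lower unipotents (`δ B δ⁻¹` preserves `𝕐 = δ(Res Δ)` — `deltaD_mulVec_diag`, `resSpD_mulVec_diag` — hence has
  zero upper-right block, `mem_closure_levi_low_of_toBlocks₁₂_eq_zero` from Mathlib's `SymplecticGroup`);
* matrix identities for `T^𝔻` and `δ` on Darboux-diagonal vectors (`gramD_mulVec_diag`, `deltaD_mulVec_diag`,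
  `exists_deltaD_mulVec_eq`; the re-enumeration bookkeeping `GRConstruction.sumElim_comp_sumCongr_e₂_symm'`, `GRConstruction.mulVec_comp_equiv_symm'`,
  `isUnit_det_gramR₀`, `coe_deltaD'` is imported from `DoubledWeilRepresentationArchLagrangian`) and a test function with `Φ(0) ≠ 0` (`exists_piSchwartzBruhat_apply_zero_ne_zero`);
* **S3** `S3_parabolic_rational`: a doubled Weil representation `sD` (`IsDoubledWeilRep χ sD`) takes values in
  `range r_F^𝔻` on `P_Δ(L⁺)` — `sD p` and `r_F^𝔻(B)` lie over the same `ι^𝔻 p` and have the same value-at-0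
  functional after `δ`-conjugation (`1`, by S3c and S3b-val of `DoubledWeilRepresentationRationalSchur`), so the
  pinning lemma applies;
* **S3′** `S3'_propagate`: agreement with `r_F^𝔻` on `P_Δ(L⁺)` propagates to its conjugate-closure, i.e. to all of
  `H(L⁺)` given S2 (central characters; abstract group theory `propagate_abstract`).
-/

set_option autoImplicit false

noncomputable section

open scoped Classical
open scoped Matrix Kronecker TensorProduct
open NumberField IsDedekindDomain
open Literature.RepresentationTheory.HeisenbergGroup
open Literature.NumberTheory.Automorphic
open Literature.NumberTheory.Weil1964
open Literature.NumberTheory.GaloisRepresentations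

namespace Literature.NumberTheory.GelbartRogawski1991.GRConstructionGen

open UnitaryDualPair

variable (F : Type) [Field F] [NumberField F] (E : Type) [Field E] [NumberField E] [Algebra F E]
  [Algebra.IsQuadraticExtension F E]
variable (c : E ≃ₐ[F] E) {δ : E} (hcδ : c δ = -δ) (hδ : δ ≠ 0) {d : F} (hd : δ * δ = algebraMap F E d)
variable {N M n : ℕ} (e : Fin N × Fin M ≃ Fin n)
  (TV : Matrix (Fin N) (Fin N) F) (hV : TV.IsSymm) (hVd : IsUnit TV.det)
  (TW : Matrix (Fin M) (Fin M) F) (hW : TW.IsSymm) (hWd : IsUnit TW.det)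

/-! #### S3-dec: the rational Siegel decomposition `δ ι^𝔻(p) δ⁻¹ ∈ ⟨m(a), v(σ)⟩` for `p ∈ P_Δ(L⁺)` -/

omit [NumberField F] in
/-- `T^𝔻 (z, z) = (T z, −T z)` in the block enumeration. [cite: GelbartRogawski1991, §3.1 Prop. 3.1.1 p. 455 L1–2] -/
theorem gramD_mulVec_diag (z : Fin n → F) :
    gramD F e TV TW *ᵥ (Sum.elim z z ∘ ⇑(e₂ (n := n)).symm) =
      Sum.elim (gramR F e TV TW *ᵥ z) (-(gramR F e TV TW *ᵥ z)) ∘ ⇑(e₂ (n := n)).symm := by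
  have h1 : Matrix.reindex (e₂ (n := n)).symm (e₂ (n := n)).symm (gramD F e TV TW) =
      Matrix.fromBlocks (gramR F e TV TW) 0 0 (-gramR F e TV TW) := by
    rw [gramD]; exact (Matrix.reindex (e₂ (n := n)) (e₂ (n := n))).symm_apply_apply _
  rw [GRConstruction.mulVec_comp_equiv_symm', h1, Matrix.fromBlocks_mulVec, Sum.elim_comp_inl, Sum.elim_comp_inr, Matrix.zero_mulVec,
    Matrix.neg_mulVec, add_zero, zero_add]

omit [NumberField F] in
/-- **`δ` maps the Darboux image of the diagonal `Δ` onto `𝕐`**: `δ (P (a,a; z,z)) = (0; (T z, −a))`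
(`deltaDiagMatrix_mulVec_diag`, re-enumerated). [cite: GelbartRogawski1991, §3.1 Prop. 3.1.1 p. 455 L1–2] -/
theorem deltaD_mulVec_diag (a z : Fin n → F) :
    ((deltaD F : Matrix.symplecticGroup (Fin (n + n)) F) :
        Matrix (Fin (n + n) ⊕ Fin (n + n)) (Fin (n + n) ⊕ Fin (n + n)) F) *ᵥ
        Sum.elim (Sum.elim a a ∘ ⇑(e₂ (n := n)).symm) (gramD F e TV TW *ᵥ (Sum.elim z z ∘ ⇑(e₂ (n := n)).symm)) =
      Sum.elim (0 : Fin (n + n) → F) (Sum.elim (gramR F e TV TW *ᵥ z) (-a) ∘ ⇑(e₂ (n := n)).symm) := by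
  have h1 : Matrix.reindex ((e₂ (n := n)).sumCongr (e₂ (n := n))).symm ((e₂ (n := n)).sumCongr (e₂ (n := n))).symm
      ((deltaD F : Matrix.symplecticGroup (Fin (n + n)) F) :
        Matrix (Fin (n + n) ⊕ Fin (n + n)) (Fin (n + n) ⊕ Fin (n + n)) F) = deltaDiagMatrix F (Fin n) := by
    rw [coe_deltaD']; exact (Matrix.reindex _ _).symm_apply_apply _
  rw [gramD_mulVec_diag, ← GRConstruction.sumElim_comp_sumCongr_e₂_symm', GRConstruction.mulVec_comp_equiv_symm', h1, deltaDiagMatrix_mulVec_diag,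
    GRConstruction.sumElim_comp_sumCongr_e₂_symm']
  rfl

include hVd hWd in
omit [NumberField F] in
/-- every `(0; y) ∈ 𝕐` is `δ` of a Darboux-diagonal vector.
[cite: GelbartRogawski1991, §3.1 Prop. 3.1.1 p. 455 L1–2] -/
theorem exists_deltaD_mulVec_eq (y : Fin (n + n) → F) : ∃ a z : Fin n → F,
    ((deltaD F : Matrix.symplecticGroup (Fin (n + n)) F) :
        Matrix (Fin (n + n) ⊕ Fin (n + n)) (Fin (n + n) ⊕ Fin (n + n)) F) *ᵥ
        Sum.elim (Sum.elim a a ∘ ⇑(e₂ (n := n)).symm) (gramD F e TV TW *ᵥ (Sum.elim z z ∘ ⇑(e₂ (n := n)).symm)) =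
      Sum.elim (0 : Fin (n + n) → F) y := by
  refine ⟨-(y ∘ ⇑(e₂ (n := n)) ∘ Sum.inr), (gramR F e TV TW)⁻¹ *ᵥ (y ∘ ⇑(e₂ (n := n)) ∘ Sum.inl), ?_⟩
  rw [deltaD_mulVec_diag, Matrix.mulVec_mulVec, Matrix.mul_nonsing_inv _ (isUnit_det_gramR₀ F e TV hVd TW hWd),
    Matrix.one_mulVec, neg_neg]
  congr 1
  funext j
  obtain ⟨k, rfl⟩ := (e₂ (n := n)).surjective j
  simp only [Function.comp_apply, Equiv.symm_apply_apply]
  rcases k with k | k <;> rfl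

/-- the Siegel block condition on the RATIONAL matrix `γ ∈ H(L⁺) ≤ GL_{n+n}(L)`.
[cite: GelbartRogawski1991, §3.1 Prop. 3.1.1 p. 455 L1–2] -/
def IsSiegelRat (γ : UnitaryGroup.rational F E c (n + n) (hermD F E e TV TW)) : Prop :=
  (Matrix.reindex (e₂ (n := n)).symm (e₂ (n := n)).symm
        ((γ : GL (Fin (n + n)) E) : Matrix (Fin (n + n)) (Fin (n + n)) E)).toBlocks₁₁ +
      (Matrix.reindex (e₂ (n := n)).symm (e₂ (n := n)).symm
        ((γ : GL (Fin (n + n)) E) : Matrix (Fin (n + n)) (Fin (n + n)) E)).toBlocks₁₂ =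
    (Matrix.reindex (e₂ (n := n)).symm (e₂ (n := n)).symm
        ((γ : GL (Fin (n + n)) E) : Matrix (Fin (n + n)) (Fin (n + n)) E)).toBlocks₂₁ +
      (Matrix.reindex (e₂ (n := n)).symm (e₂ (n := n)).symm
        ((γ : GL (Fin (n + n)) E) : Matrix (Fin (n + n)) (Fin (n + n)) E)).toBlocks₂₂

omit [NumberField F] [Algebra.IsQuadraticExtension F E] in
/-- `IsSiegelDelta (γ ⊗ 1) → IsSiegelRat γ` (injectivity of `L → 𝔸_L`).
[cite: GelbartRogawski1991, §3.1 Prop. 3.1.1 p. 455 L1–2] -/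
theorem isSiegelRat_of_isSiegelDelta
    (γ : UnitaryGroup.rational F E c (n + n) (hermD F E e TV TW))
    (hS : IsSiegelDelta F E c e TV TW
      (UnitaryGroup.toAdelic F E c (n + n) (hermD F E e TV TW) γ)) :
    IsSiegelRat F E c e TV TW γ := by
  refine Matrix.map_injective (AdeleRing.algebraMap_injective (𝓞 E) E) ?_
  beta_reduce
  rw [Matrix.map_add _ (map_add _), Matrix.map_add _ (map_add _)]
  exact hS

omit [NumberField F] [NumberField E] [Algebra.IsQuadraticExtension F E] in
/-- a Siegel `γ` maps diagonal vectors `(W, W)` to diagonal vectors.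
[cite: GelbartRogawski1991, §3.1 Prop. 3.1.1 p. 455 L1–2] -/
theorem mulVec_diag_of_isSiegelRat
    (γ : UnitaryGroup.rational F E c (n + n) (hermD F E e TV TW))
    (hS : IsSiegelRat F E c e TV TW γ) (W : Fin n → E) :
    ((γ : GL (Fin (n + n)) E) : Matrix (Fin (n + n)) (Fin (n + n)) E) *ᵥ (Sum.elim W W ∘ ⇑(e₂ (n := n)).symm) =
      Sum.elim
        (((Matrix.reindex (e₂ (n := n)).symm (e₂ (n := n)).symm
            ((γ : GL (Fin (n + n)) E) : Matrix (Fin (n + n)) (Fin (n + n)) E)).toBlocks₁₁ +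
          (Matrix.reindex (e₂ (n := n)).symm (e₂ (n := n)).symm
            ((γ : GL (Fin (n + n)) E) : Matrix (Fin (n + n)) (Fin (n + n)) E)).toBlocks₁₂) *ᵥ W)
        (((Matrix.reindex (e₂ (n := n)).symm (e₂ (n := n)).symm
            ((γ : GL (Fin (n + n)) E) : Matrix (Fin (n + n)) (Fin (n + n)) E)).toBlocks₁₁ +
          (Matrix.reindex (e₂ (n := n)).symm (e₂ (n := n)).symm
            ((γ : GL (Fin (n + n)) E) : Matrix (Fin (n + n)) (Fin (n + n)) E)).toBlocks₁₂) *ᵥ W) ∘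
        ⇑(e₂ (n := n)).symm := by
  rw [GRConstruction.mulVec_comp_equiv_symm']
  set G := Matrix.reindex (e₂ (n := n)).symm (e₂ (n := n)).symm
    ((γ : GL (Fin (n + n)) E) : Matrix (Fin (n + n)) (Fin (n + n)) E) with hG
  have h1 : G *ᵥ Sum.elim W W = Sum.elim ((G.toBlocks₁₁ + G.toBlocks₁₂) *ᵥ W) ((G.toBlocks₂₁ + G.toBlocks₂₂) *ᵥ W) := by
    conv_lhs => rw [← Matrix.fromBlocks_toBlocks G]
    rw [Matrix.fromBlocks_mulVec, Sum.elim_comp_inl, Sum.elim_comp_inr, Matrix.add_mulVec, Matrix.add_mulVec]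
  rw [h1]
  change _ = _ at hS
  rw [← hS]

/-- **the rational restriction-of-scalars matrix of `γ ∈ H(L⁺)`** in Mathlib's symplectic coordinates of `𝕎^𝔻`
(`untransportSp T^𝔻 ∘ rationalToSymplectic`). [cite: GelbartRogawski1991, §3.1 Prop. 3.1.1 p. 455 L1–2] -/
def resSpD (γ : UnitaryGroup.rational F E c (n + n) (hermD F E e TV TW)) :
    Matrix.symplecticGroup (Fin (n + n)) F :=
  UnitaryGroup.SpTransport.untransportSp (gramD F e TV TW) (isUnit_det_gramD F e TV hVd TW hWd)
    (UnitaryGroup.rationalToSymplectic F E c (n + n) hcδ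
      hδ hd (gramD_isSymm F e TV hV TW hW) rfl γ)

include hVd hWd in
/-- `ratSp (resSpD γ) = ι^𝔻 (γ ⊗ 1)` (tree `adelicToSymplectic_toAdelic_eq_transportSp`).
[cite: GelbartRogawski1991, §3.1 Prop. 3.1.1 p. 455 L1–2] -/
theorem ratSp_resSpD (γ : UnitaryGroup.rational F E c (n + n) (hermD F E e TV TW)) :
    ratSp F (gramDA F e TV TW) (isUnit_det_gramDA F e TV hVd TW hWd)
        (resSpD F E c hcδ hδ hd e TV hV hVd TW hW hWd γ) =
      toSpD F E c hcδ hδ hd e TV hV TW hW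
        (UnitaryGroup.toAdelic F E c (n + n) (hermD F E e TV TW) γ) :=
  (UnitaryGroup.adelicToSymplectic_toAdelic_eq_transportSp F E c (n + n)
    hcδ hδ hd (gramD_isSymm F e TV hV TW hW)
    (isUnit_det_gramD F e TV hVd TW hWd) (isUnit_det_gramDA F e TV hVd TW hWd) rfl γ).symm

include hVd hWd in
/-- a Siegel `γ` preserves the Darboux image of the diagonal: `resSpD γ` maps `P(a,a; z,z)` to a vector of the same shape.
[cite: GelbartRogawski1991, §3.1 Prop. 3.1.1 p. 455 L1–2] -/
theorem resSpD_mulVec_diag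
    (γ : UnitaryGroup.rational F E c (n + n) (hermD F E e TV TW))
    (hS : IsSiegelRat F E c e TV TW γ) (a z : Fin n → F) : ∃ a' z' : Fin n → F,
    ((resSpD F E c hcδ hδ hd e TV hV hVd TW hW hWd γ : Matrix.symplecticGroup (Fin (n + n)) F) :
        Matrix (Fin (n + n) ⊕ Fin (n + n)) (Fin (n + n) ⊕ Fin (n + n)) F) *ᵥ
        Sum.elim (Sum.elim a a ∘ ⇑(e₂ (n := n)).symm) (gramD F e TV TW *ᵥ (Sum.elim z z ∘ ⇑(e₂ (n := n)).symm)) =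
      Sum.elim (Sum.elim a' a' ∘ ⇑(e₂ (n := n)).symm)
        (gramD F e TV TW *ᵥ (Sum.elim z' z' ∘ ⇑(e₂ (n := n)).symm)) := by
  obtain ⟨Ψ, hΨ⟩ : ∃ Ψ : (F × F) ≃+ E, ∀ x : Fin (n + n) → E,
      (UnitaryGroup.rationalToSymplectic F E c (n + n) hcδ
          hδ hd (gramD_isSymm F e TV hV TW hW) rfl γ).1
          (UnitaryGroup.QuadraticCoordinates.reIm Ψ (Fin (n + n)) x) =
        UnitaryGroup.QuadraticCoordinates.reIm Ψ (Fin (n + n))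
          (((γ : GL (Fin (n + n)) E) : Matrix (Fin (n + n)) (Fin (n + n)) E) *ᵥ x) :=
    ⟨_, UnitaryGroup.rationalToSymplectic_reIm F E c (n + n) hcδ
      hδ hd (gramD_isSymm F e TV hV TW hW) rfl γ⟩
  set W : Fin n → E := fun i => Ψ (a i, z i) with hWdef
  have h1 : (Sum.elim a a ∘ ⇑(e₂ (n := n)).symm, Sum.elim z z ∘ ⇑(e₂ (n := n)).symm) =
      UnitaryGroup.QuadraticCoordinates.reIm Ψ (Fin (n + n)) (Sum.elim W W ∘ ⇑(e₂ (n := n)).symm) := by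
    rw [← GRConstruction.reIm_symm_diag' Ψ a z, AddEquiv.apply_symm_apply]
  obtain ⟨W', hW'⟩ : ∃ W' : Fin n → E,
      ((γ : GL (Fin (n + n)) E) : Matrix (Fin (n + n)) (Fin (n + n)) E) *ᵥ (Sum.elim W W ∘ ⇑(e₂ (n := n)).symm) =
        Sum.elim W' W' ∘ ⇑(e₂ (n := n)).symm :=
    ⟨_, mulVec_diag_of_isSiegelRat F E c e TV TW γ hS W⟩
  have h2 := hΨ (Sum.elim W W ∘ ⇑(e₂ (n := n)).symm)
  rw [← h1, hW', GRConstruction.reIm_diag'] at h2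
  refine ⟨fun i => UnitaryGroup.QuadraticCoordinates.re Ψ (W' i), fun i => UnitaryGroup.QuadraticCoordinates.im Ψ (W' i), ?_⟩
  rw [resSpD, UnitaryGroup.SpTransport.coe_untransportSp]
  have hdarb : Sum.elim (Sum.elim a a ∘ ⇑(e₂ (n := n)).symm)
      (gramD F e TV TW *ᵥ (Sum.elim z z ∘ ⇑(e₂ (n := n)).symm)) =
      SymplecticMatrix.darboux (gramD F e TV TW) (isUnit_det_gramD F e TV hVd TW hWd)
        (Sum.elim a a ∘ ⇑(e₂ (n := n)).symm, Sum.elim z z ∘ ⇑(e₂ (n := n)).symm) := rfl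
  rw [hdarb, UnitaryGroup.SpTransport.untransportMatrix_mulVec, LinearEquiv.symm_apply_apply]
  change SymplecticMatrix.darboux _ _ ((UnitaryGroup.rationalToSymplectic F E c (n + n)
    hcδ hδ hd (gramD_isSymm F e TV hV TW hW) rfl γ).1
    (Sum.elim a a ∘ ⇑(e₂ (n := n)).symm, Sum.elim z z ∘ ⇑(e₂ (n := n)).symm)) = _
  rw [h2]
  rfl

include hVd hWd in
/-- **S3-dec (RATIONAL SIEGEL DECOMPOSITION)**: for a rational Siegel `p = γ ⊗ 1`, `B := resSpD γ` satisfies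
`ratSp B = ι^𝔻 p` and `δ B δ⁻¹` is block-lower-triangular (it preserves `𝕐 = δ(P Δ)`), hence `= v(σ) m(a)`.
[cite: GelbartRogawski1991, §3.1 Prop. 3.1.1 p. 455 L1–2] -/
theorem S3dec_siegel_decomposition (p : HA F E c e TV TW) (hp : p ∈ ratH F E c e TV TW)
    (hS : IsSiegelDelta F E c e TV TW p) :
    ∃ B : Matrix.symplecticGroup (Fin (n + n)) F,
      ratSp F (gramDA F e TV TW) (isUnit_det_gramDA F e TV hVd TW hWd) B = toSpD F E c hcδ hδ hd e TV hV TW hW p ∧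
      deltaD F * B * (deltaD F)⁻¹ ∈ Submonoid.closure ((Set.range (SymplecticMatrix.levi (l := Fin (n + n)) (R := F))) ∪
        {x | ∃ σ hσ, x = SymplecticMatrix.low (l := Fin (n + n)) (R := F) σ hσ}) := by
  obtain ⟨γ, rfl⟩ := hp
  have hS' := isSiegelRat_of_isSiegelDelta F E c e TV TW γ hS
  refine ⟨resSpD F E c hcδ hδ hd e TV hV hVd TW hW hWd γ, ratSp_resSpD F E c hcδ hδ hd e TV hV hVd TW hW hWd γ, ?_⟩
  apply GRConstruction.mem_closure_levi_low_of_toBlocks₁₂_eq_zero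
  apply GRConstruction.toBlocks₁₂_eq_zero_of_mulVec
  intro y
  obtain ⟨a, z, hy⟩ := exists_deltaD_mulVec_eq F e TV hVd TW hWd y
  obtain ⟨a', z', hB⟩ := resSpD_mulVec_diag F E c hcδ hδ hd e TV hV hVd TW hW hWd γ hS' a z
  refine ⟨Sum.elim (gramR F e TV TW *ᵥ z') (-a') ∘ ⇑(e₂ (n := n)).symm, ?_⟩
  have hinv : (((deltaD F)⁻¹ : Matrix.symplecticGroup (Fin (n + n)) F) :
      Matrix (Fin (n + n) ⊕ Fin (n + n)) (Fin (n + n) ⊕ Fin (n + n)) F) *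
      ((deltaD F : Matrix.symplecticGroup (Fin (n + n)) F) : Matrix _ _ F) = 1 := by
    rw [← Submonoid.coe_mul, inv_mul_cancel]; rfl
  have hδu : (((deltaD F)⁻¹ : Matrix.symplecticGroup (Fin (n + n)) F) :
      Matrix (Fin (n + n) ⊕ Fin (n + n)) (Fin (n + n) ⊕ Fin (n + n)) F) *ᵥ
      (((deltaD F : Matrix.symplecticGroup (Fin (n + n)) F) : Matrix _ _ F) *ᵥ
        Sum.elim (Sum.elim a a ∘ ⇑(e₂ (n := n)).symm)
          (gramD F e TV TW *ᵥ (Sum.elim z z ∘ ⇑(e₂ (n := n)).symm))) =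
      Sum.elim (Sum.elim a a ∘ ⇑(e₂ (n := n)).symm)
        (gramD F e TV TW *ᵥ (Sum.elim z z ∘ ⇑(e₂ (n := n)).symm)) := by
    rw [Matrix.mulVec_mulVec, hinv, Matrix.one_mulVec]
  rw [Submonoid.coe_mul, Submonoid.coe_mul, ← Matrix.mulVec_mulVec, ← Matrix.mulVec_mulVec, ← hy, hδu, hB,
    deltaD_mulVec_diag]

/-! #### S3: the rational parabolic clause, assembled -/

omit [Algebra.IsQuadraticExtension F E] in
/-- **S3-ne**: `𝒮(𝔸^{n+n})` has a function with `Φ(0) ≠ 0` — `φ₀ ⊗ 𝟙_{𝒪̂^{n+n}}` (`unitSchwartz ⊗ indicatorSB`,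
`coe_piSchwartzBruhatEquiv_tmul`, `unitSchwartz_apply_zero`).
[cite: GelbartRogawski1991, §3.1 Prop. 3.1.1 p. 455 L1–2] -/
theorem exists_piSchwartzBruhat_apply_zero_ne_zero :
    ∃ Φ : piSchwartzBruhat F (Fin (n + n)), (Φ : (Fin (n + n) → AdeleRing (𝓞 F) F) → ℂ) 0 ≠ 0 := by
  refine ⟨piSchwartzBruhatEquiv F (Fin (n + n)) (unitSchwartz F (Fin (n + n)) ⊗ₜ[ℂ]
    indicatorSB F (Fin (n + n)) (piLevelIdeal F (Fin (n + n)) ⊤) (isOpen_piLevelIdeal F ⊤)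
      (isCompact_piLevelIdeal F (Fin (n + n)) ⊤)), ?_⟩
  rw [coe_piSchwartzBruhatEquiv_tmul]
  have h0 : piArch F (Fin (n + n)) 0 = 0 := by
    funext i
    rw [piArch_apply, Pi.zero_apply]
    exact map_zero (InfiniteAdeleRing.ringEquiv_mixedSpace F)
  have h1 : piFinite F (Fin (n + n)) 0 = 0 := rfl
  simp only [h0, h1, unitSchwartz_apply_zero, one_mul, coe_indicatorSB]
  rw [Set.indicator_of_mem (show (0 : Fin (n + n) → FiniteAdeleRing (𝓞 F) F) ∈
    (piLevelIdeal F (Fin (n + n)) ⊤ : Set _) from (piLevelIdeal F (Fin (n + n)) ⊤).zero_mem)]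
  exact one_ne_zero

include hVd hWd in
set_option maxHeartbeats 1600000 in
set_option synthInstance.maxHeartbeats 400000 in
/-- **S3 (RATIONAL PARABOLIC CLAUSE)** from S3-dec
and S3-unit, S3-ne, S3b-val, S3c and the pinning lemma: on `P_Δ(L⁺)` the prescribed values ARE Weil's rational section,
`sD p ∈ range r_F^𝔻`.  From S3-dec get `B` with `ι^𝔻 p = ratSp B` and `δ B δ⁻¹` in the Levi∕unipotent submonoid; then
`r_δ · r_F^𝔻(B) · r_δ⁻¹ = r_F^𝔻(δ B δ⁻¹)` fixes values at `0` (S3b-val), `sD p`'s `δ`-conjugate multiplies them by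
`χ(det_Δ p)|det_Δ p|^{1/2} = 1` (prescription + S3c), both lie over the same point of `Sp(𝔸)` — so they are equal (`S3_abstract` +
`eq_of_proj_eq_of_evalZero_eq` + S3-ne). [cite: GelbartRogawski1991, §3.1 Prop. 3.1.1 p. 455 L1–2] -/
theorem S3_parabolic_rational (χ : HeckeCharacter E) {sD : HA F E c e TV TW →* MpD F e TV TW}
    (hs : IsDoubledWeilRep F E c hcδ hδ hd e TV hV hVd TW hW hWd χ sD) :
    ∀ p ∈ ratH F E c e TV TW, IsSiegelDelta F E c e TV TW p → sD p ∈ (rFD F e TV hVd TW hWd).range := by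
  intro p hp hS
  have hu := isUnit_detDelta_of_isSiegelDelta F E c e TV TW p hS
  have hone := chiDet_mul_modDelta_eq_one_of_rational F E c e TV TW χ p hp hu
  have hpar := hs.parabolic p hS hu
  have hpe := hs.proj_eq p
  refine (S3dec_siegel_decomposition F E c hcδ hδ hd e TV hV hVd TW hW hWd p hp hS).elim fun B hB => ⟨B, ?_⟩
  have h3 : rFD F e TV hVd TW hWd (deltaD F * B * (deltaD F)⁻¹) =
      rDelta F e TV hVd TW hWd * rFD F e TV hVd TW hWd B * (rDelta F e TV hVd TW hWd)⁻¹ :=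
    ((rFD F e TV hVd TW hWd).map_mul (deltaD F * B) (deltaD F)⁻¹).trans
      (congr (congrArg (· * ·) ((rFD F e TV hVd TW hWd).map_mul (deltaD F) B))
        ((rFD F e TV hVd TW hWd).map_inv (deltaD F)))
  have hmem : rDelta F e TV hVd TW hWd * rFD F e TV hVd TW hWd B *
      (rDelta F e TV hVd TW hWd)⁻¹ ∈ evalZeroFixing F e TV TW := by
    have h := rFD_mem_evalZeroFixing_of_mem_closure F e TV hVd TW hWd hB.2
    rw [h3] at h
    exact h
  have hval : ∀ Φ : piSchwartzBruhat F (Fin (n + n)),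
      opD F e TV TW (rDelta F e TV hVd TW hWd * rFD F e TV hVd TW hWd B *
          (rDelta F e TV hVd TW hWd)⁻¹) Φ 0 =
        (Φ : (Fin (n + n) → AdeleRing (𝓞 F) F) → ℂ) 0 := hmem
  have hπ : projD F e TV TW (rFD F e TV hVd TW hWd B) = projD F e TV TW (sD p) :=
    (proj_ratThetaLiftCont F (gramDA F e TV TW) (isUnit_det_gramDA F e TV hVd TW hWd) B).trans
      (hB.1.trans (hpe).symm)
  exact GRConstruction.S3_abstract (projD F e TV TW) (piSchwartzBruhat F (Fin (n + n)))
    (fun q Φ => opD F e TV TW q Φ 0) (eq_of_proj_eq_of_evalZero_eq F e TV hVd TW hWd)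
    (rDelta F e TV hVd TW hWd) _ _ hπ
    (fun Φ => (hval Φ).trans (((one_mul _).symm.trans (congrArg (· * _) hone.symm)).trans (hpar Φ).symm))
    ((exists_piSchwartzBruhat_apply_zero_ne_zero F).elim fun Φ hΦ => ⟨Φ, fun h0 => hΦ ((hval Φ).symm.trans h0)⟩)

/-- **S3′ (CENTRAL-CHARACTER PROPAGATION)** (from S3a, S3b via `propagate_abstract`): `sD` and `r_F^𝔻 ∘ ι^𝔻` agree on
the subgroup generated by the `H(L⁺)`-conjugates of the elements of `P_Δ(L⁺)` where they agree.
[cite: GelbartRogawski1991, §3.1 Prop. 3.1.1 p. 455 L1–2] -/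
theorem S3'_propagate (χ : HeckeCharacter E) {sD : HA F E c e TV TW →* MpD F e TV TW}
    (hs : IsDoubledWeilRep F E c hcδ hδ hd e TV hV hVd TW hW hWd χ sD)
    (hP : ∀ p ∈ ratH F E c e TV TW, IsSiegelDelta F E c e TV TW p → sD p ∈ (rFD F e TV hVd TW hWd).range)
    (hgen : ∀ γ ∈ ratH F E c e TV TW, γ ∈ Subgroup.closure
      {x : HA F E c e TV TW | ∃ p ∈ ratH F E c e TV TW, ∃ h ∈ ratH F E c e TV TW,
        IsSiegelDelta F E c e TV TW p ∧ x = h * p * h⁻¹}) :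
    ∀ γ ∈ ratH F E c e TV TW, sD γ ∈ (rFD F e TV hVd TW hWd).range :=
  GRConstruction.propagate_abstract (projD F e TV TW) (toSpD F E c hcδ hδ hd e TV hV TW hW) sD (rFD F e TV hVd TW hWd)
    (ratSp F (gramDA F e TV TW) (isUnit_det_gramDA F e TV hVd TW hWd))
    (proj_ratThetaLiftCont F (gramDA F e TV TW) (isUnit_det_gramDA F e TV hVd TW hWd))
    hs.proj_eq (S3a_central_of_proj_eq_one F e TV hVd TW hWd) (ratH F E c e TV TW)
    (toSpD_mem_range_ratSp F E c hcδ hδ hd e TV hV hVd TW hW hWd) {p | IsSiegelDelta F E c e TV TW p} hP hgen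

end Literature.NumberTheory.GelbartRogawski1991.GRConstructionGen
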